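import Literature.RepresentationTheory.Kovacevic2021.SU21RelativeCochainsDegreeTwo
import HarnessLib

/-!
# Kovačević's `SU(2,1)`-modules: `C²(𝔤, 𝔨; V) ≅ Hom_𝔨(Λ²𝔭, V)` as a product of four highest-weight lines

Topic `RepresentationTheory/Kovacevic2021`; namespace `Literature.RepresentationTheory.Kovacevic2021`.
Definitions with bodies and theorems only; no named fact.  Completes `SU21RelativeCochainsDegreeTwo`: the
`2`-cochain `twoCochain w₁ w₂ w₃ w₄` attached to `𝔨`-highest-weight vectors of types `(1,6)`, `(3,0)`,
`(1,0)`, `(1,-6)` IS relative (`twoCochain_mem` — the `𝔨`-equivariance of the pairing, checked on the bases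
`u¹_{1,±6}`, `u¹_{1,0}`, `u¹, u², u³` of `V_{3,0}` [Kovacevic2021, §3 Def 1]), so that

* **`C²(𝔤, 𝔨; V) ≃ₗ hw(1,6) × hw(3,0) × hw(1,0) × hw(1,-6)`** (`relCochainTwoEquiv`,
  `f ↦ (f(E₀₂,E₁₂), f(E₀₂,E₂₁), -f(E₀₂,E₂₀) - f(E₁₂,E₂₁), f(E₂₀,E₂₁))`), i.e. Borel–Wallach's
  `C²(𝔤,𝔨;V) = Hom_𝔨(Λ²𝔭, V)` with `Λ²𝔭 = F_{2,0} ⊕ F_{1,1} ⊕ F_{0,0} ⊕ F_{0,2}`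
  [BorelWallach2000, I §1.2, VI 4.8 (5), Lemma 4.9 (1)] combined with multiplicity one;
* **`dim C²(𝔤, 𝔨; V) = [(1,6) ∈ S] + [(3,0) ∈ S] + [(1,0) ∈ S] + [(1,-6) ∈ S]`** (`finrank_relCochain_two`) and
  `C² = 0` when none of the four is a `K`-type (`relCochain_two_eq_bot`).

## References

* A. Borel, N. Wallach (2000), I §1.2 (1); VI 4.8 (4)–(5), Lemma 4.9 (1), Thm 4.11 (11), pp. 130–133 (held
  chunks p0059, p0165–p0168). [BorelWallach2000]
* D. Kovačević, Acta Math. Spalatensia 1 (2021) 105–125, §3 Def 1, Thm 1. [Kovacevic2021]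
-/

noncomputable section

open Finsupp Module
open Literature.Algebra.Lie Literature.Algebra.Lie.ChevalleyEilenberg

namespace Literature.RepresentationTheory.Kovacevic2021

-- Mathlib idiom (Mathlib/Algebra/Lie/OfAssociative.lean): bracket on `Matrix`/`Module.End` = commutator.
attribute [local instance 100] LieRing.ofAssociativeRing

namespace SU21Datum

variable (𝒟 : SU21Datum)

-- one uniform expansion of the `𝔨`-action on `u¹_{1,±6}`, `u¹_{1,0}`, `u¹..u³_{3,0}`; which simp lemmas fire varies
set_option linter.unusedSimpArgs false in
variable {𝒟} in
/-- **`twoCochain w₁ w₂ w₃ w₄` is a relative `2`-cochain** for `𝔨`-highest-weight vectors `wᵢ` of types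
`(1,6)`, `(3,0)`, `(1,0)`, `(1,-6)` (the pairing is `𝔨`-equivariant and vanishes on `𝔨`).
[cite: BorelWallach2000, I §1.2 (1), VI Lemma 4.9 (1)] [cite: Kovacevic2021, §3 Def 1] -/
theorem twoCochain_mem {w₁ w₂ w₃ w₄ : 𝒟.V} (h₁ : w₁ ∈ 𝒟.hwSpace 1 6) (h₂ : w₂ ∈ 𝒟.hwSpace 3 0)
    (h₃ : w₃ ∈ 𝒟.hwSpace 1 0) (h₄ : w₄ ∈ 𝒟.hwSpace 1 (-6)) : 𝒟.twoCochain w₁ w₂ w₃ w₄ ∈ 𝒟.relCochain 2 := by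
  rw [hwSpace_eq_span, Submodule.mem_span_singleton] at h₁ h₂ h₃ h₄
  obtain ⟨c₁, rfl⟩ := h₁
  obtain ⟨c₂, rfl⟩ := h₂
  obtain ⟨c₃, rfl⟩ := h₃
  obtain ⟨c₄, rfl⟩ := h₄
  rw [mem_relCochain_two_iff]
  refine ⟨fun x hx y z => ?_, fun x hx z => ?_⟩
  · obtain ⟨h02, h12, h20, h21⟩ := (mem_kSub_iff x).1 hx
    simp only [twoCochain_apply, Matrix.cons_val_zero, Matrix.cons_val_one, Matrix.head_cons, pairForm_apply,
      lie_def]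
    simp (disch := omega) only [ρfun, h02, h12, h20, h21, zero_smul, add_zero, LinearMap.add_apply,
      LinearMap.smul_apply, map_add, map_sub, map_smul, map_neg, map_zero, LieRing.of_associative_ring_bracket,
      Matrix.sub_apply, Matrix.mul_apply, Fin.sum_univ_three, Ha_vec, Hb_vec, Xa_vec, Ya_vec 3 0 le_rfl,
      Ya_vec 3 0 (show (1 : ℤ) ≤ 1 + 1 by omega), Ya_vec 3 0 (show (1 : ℤ) ≤ 1 + 1 + 1 by omega), Ya_vec 1 6 le_rfl,
      Ya_vec 1 0 le_rfl, Ya_vec 1 (-6) le_rfl, vec_of_not_range, smul_add, smul_sub, smul_neg, smul_smul,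
      smul_zero, neg_zero, sub_zero, Int.cast_add, Int.cast_sub, Int.cast_one, Int.cast_ofNat, Int.cast_zero,
      Int.cast_neg, mul_zero, zero_mul, mul_one, zero_add, add_zero, neg_neg, add_sub_cancel_right, sub_add_cancel,
      zero_sub, sub_self]
    match_scalars <;> ring
  · obtain ⟨h02, h12, h20, h21⟩ := (mem_kSub_iff x).1 hx
    simp only [twoCochain_apply, Matrix.cons_val_zero, Matrix.cons_val_one, Matrix.head_cons, pairForm_apply, h02,
      h12, h20, h21]
    simp

/-- **`C²(𝔤, 𝔨; V) ≅ {hw vectors of type (1,6)} × {(3,0)} × {(1,0)} × {(1,-6)}`** (`= Hom_𝔨(Λ²𝔭, V)` with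
`Λ²𝔭 = F_{2,0} ⊕ F_{1,1} ⊕ F_{0,0} ⊕ F_{0,2}`). [cite: BorelWallach2000, I §1.2 (1), VI 4.8 (5), Lemma 4.9 (1)] -/
def relCochainTwoEquiv :
    𝒟.relCochain 2 ≃ₗ[ℂ] (𝒟.hwSpace 1 6 × (𝒟.hwSpace 3 0 × (𝒟.hwSpace 1 0 × 𝒟.hwSpace 1 (-6)))) where
  toFun f := (⟨f.1 ![E 0 2, E 1 2], apply_E02_E12_mem_hwSpace f.2⟩, ⟨f.1 ![E 0 2, E 2 1], apply_E02_E21_mem_hwSpace f.2⟩,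
    ⟨-f.1 ![E 0 2, E 2 0] - f.1 ![E 1 2, E 2 1], apply_L_mem_hwSpace f.2⟩, ⟨f.1 ![E 2 0, E 2 1], apply_E20_E21_mem_hwSpace f.2⟩)
  map_add' f g := by
    ext <;> simp only [Submodule.coe_add, AlternatingMap.add_apply, Prod.mk_add_mk]
    abel
  map_smul' c f := by
    ext <;> simp only [Submodule.coe_smul, AlternatingMap.smul_apply, Prod.smul_mk, RingHom.id_apply, smul_sub,
      smul_neg]
  invFun w := ⟨𝒟.twoCochain w.1.1 w.2.1.1 w.2.2.1.1 w.2.2.2.1, twoCochain_mem w.1.2 w.2.1.2 w.2.2.1.2 w.2.2.2.2⟩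
  left_inv f := Subtype.ext (eq_twoCochain f.2).symm
  right_inv w := by
    obtain ⟨⟨w₁, hw₁⟩, ⟨w₂, hw₂⟩, ⟨w₃, hw₃⟩, ⟨w₄, hw₄⟩⟩ := w
    have hY₃ : 𝒟.Ya w₃ = 0 := by
      rw [hwSpace_eq_span, Submodule.mem_span_singleton] at hw₃
      obtain ⟨c, rfl⟩ := hw₃
      rw [map_smul, Ya_vec 1 0 le_rfl, vec_of_not_range 0 (Or.inr (by omega)), neg_zero, smul_zero]
    refine Prod.ext ?_ (Prod.ext ?_ (Prod.ext ?_ ?_)) <;> apply Subtype.ext <;> simp [pairForm_apply, hY₃]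
    module

open Classical in
/-- **`dim C²(𝔤, 𝔨; V) = [(1,6) ∈ S] + [(3,0) ∈ S] + [(1,0) ∈ S] + [(1,-6) ∈ S]`** (the `K`-types of `Λ²𝔭`,
each occurring in `V` at most once). [cite: BorelWallach2000, VI 4.8 (5), Lemma 4.9 (1), Thm 4.11 (11)] -/
theorem finrank_relCochain_two :
    finrank ℂ (𝒟.relCochain 2) =
      (if ((1 : ℤ), (6 : ℤ)) ∈ 𝒟.S then 1 else 0) + (if ((3 : ℤ), (0 : ℤ)) ∈ 𝒟.S then 1 else 0)
        + (if ((1 : ℤ), (0 : ℤ)) ∈ 𝒟.S then 1 else 0) + (if ((1 : ℤ), (-6 : ℤ)) ∈ 𝒟.S then 1 else 0) := by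
  rw [LinearEquiv.finrank_eq 𝒟.relCochainTwoEquiv, Module.finrank_prod, Module.finrank_prod, Module.finrank_prod,
    finrank_hwSpace, finrank_hwSpace, finrank_hwSpace, finrank_hwSpace]
  ring

/-- `C²(𝔤, 𝔨; V) = 0` if none of `V_{1,6}, V_{3,0}, V_{1,0}, V_{1,-6}` is a `K`-type of `V`.
[cite: BorelWallach2000, VI Thm 4.11 (11)] -/
theorem relCochain_two_eq_bot (h₁ : ((1 : ℤ), (6 : ℤ)) ∉ 𝒟.S) (h₂ : ((3 : ℤ), (0 : ℤ)) ∉ 𝒟.S)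
    (h₃ : ((1 : ℤ), (0 : ℤ)) ∉ 𝒟.S) (h₄ : ((1 : ℤ), (-6 : ℤ)) ∉ 𝒟.S) : 𝒟.relCochain 2 = ⊥ := by
  rw [Submodule.eq_bot_iff]
  intro f hf
  have e1 : f ![E 0 2, E 1 2] = 0 := by
    have h := apply_E02_E12_mem_hwSpace hf
    rwa [hwSpace_eq_span, vec_of_not_mem 1 h₁, Submodule.span_zero_singleton, Submodule.mem_bot] at h
  have e2 : f ![E 0 2, E 2 1] = 0 := by
    have h := apply_E02_E21_mem_hwSpace hf
    rwa [hwSpace_eq_span, vec_of_not_mem 1 h₂, Submodule.span_zero_singleton, Submodule.mem_bot] at h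
  have e3 : -f ![E 0 2, E 2 0] - f ![E 1 2, E 2 1] = 0 := by
    have h := apply_L_mem_hwSpace hf
    rwa [hwSpace_eq_span, vec_of_not_mem 1 h₃, Submodule.span_zero_singleton, Submodule.mem_bot] at h
  have e4 : f ![E 2 0, E 2 1] = 0 := by
    have h := apply_E20_E21_mem_hwSpace hf
    rwa [hwSpace_eq_span, vec_of_not_mem 1 h₄, Submodule.span_zero_singleton, Submodule.mem_bot] at h
  rw [eq_twoCochain hf, e1, e2, e3, e4]
  refine AlternatingMap.ext fun v => ?_
  simp [pairForm_apply]

end SU21Datum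

end Literature.RepresentationTheory.Kovacevic2021
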